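import Literature.Geometry.Lorentzian.WindowedCollarCurvatureTracking
import Literature.Geometry.Lorentzian.KerrCurvatureInvariants
import HarnessLib

/-!
# A curvature floor on the slowly rotating Kerr horizon collar: `|Rm|² ≥ 2M²/r⁶` for `r ≥ 4|a|`
(crux `LaminatedThreshold`, idea `horizon-shadowed-bag`, piece (s3c), curvature wall)

The second "first Lean-able piece" of the CURVATURE WALL route to (s3c) `NoFlatChartInLateBag`
named by `Cruxes/LaminatedThreshold/TRIAGE-r2-1.md`, sharpen (3): "`|K| ≥ c/M⁴` on a collar of the
Kerr horizon, `|a| ≪ M`" (companion of `LaminatedThresholdFlatChartCurvature.lean`, which bounds the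
Kretschmann scalar ABOVE by `A δ²` on `δ`-quiet flat-chart slabs: together, a late flat-chart image
cannot cross a region that is `C²`-close to a slowly rotating Kerr horizon collar).

From the closed form `|Rm|² = 48 M² Re[(r + i a cos θ)⁶]/(r² + a² cos² θ)⁶` (Visser
arXiv:0706.0622 §3; PROVED in the tree, `Kerr.kretschmannScalar_closedForm_holds`) and the
elementary estimate `(r² + b²)⁶ ≤ 24 Re[(r + ib)⁶] r⁶` for `b² ≤ r²/16`
(`pow_six_le_of_sq_le`): wherever the Kerr–Schild radius satisfies `r ≥ 4|a|` (in particular on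
the whole chart when `r₀ ≥ 4|a|`, e.g. across the horizon `r₊ ∈ [M, 2M]` of a hole with
`|a| ≤ r₀/4`), `|Rm|²_{g_{M,a}}(x) ≥ 2M²/r⁶` (`le_rmNormSqAt_kerrBilin_of_le_radius`, coordinate
level, unconditional; `le_kretschmannAt_kerr_of_le_radius`, for the Kerr spacetime), hence
`≥ 2/(729 M⁴)` on the collar `{r ≤ 3M}` (`le_kretschmannAt_kerr_collar`). Everything PROVED; the
instance hypothesis `[Kerr.Facts]` of `Kerr.spacetime` is the house pattern (it is itself discharged
in the tree, `Kerr.contMDiff_bilin_holds` &c.).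
-/

noncomputable section

set_option linter.dupNamespace false

open Set Function Filter Metric
open scoped Topology Manifold ContDiff

namespace Summit.FinalStateConjecture.FinalStateConjecture.Theorems.LaminatedThreshold.HorizonShadowedBag

open Literature.Geometry.Lorentzian Literature.Geometry.Lorentzian.MetricCoord
  Literature.Geometry.Lorentzian.KerrWindow

/-- **The sextic estimate.** For `b² ≤ r²/16`:
`(r² + b²)⁶ ≤ (17/16)⁶ r¹² ≤ (6120/4096) r¹² ≤ 24 (r⁶ − 15r⁴b² + 15r²b⁴ − b⁶) r⁶`
(the middle factor is `≥ (1/16 − 1/4096) r⁶ = (255/4096) r⁶`). [folklore] -/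
theorem pow_six_le_of_sq_le {r b : ℝ} (hb : b ^ 2 ≤ r ^ 2 / 16) :
    (r ^ 2 + b ^ 2) ^ 6 ≤ 24 * (r ^ 6 - 15 * r ^ 4 * b ^ 2 + 15 * r ^ 2 * b ^ 4 - b ^ 6) * r ^ 6 := by
  have hb0 : 0 ≤ b ^ 2 := sq_nonneg b
  have hr0 : 0 ≤ r ^ 2 := sq_nonneg r
  have hr6 : 0 ≤ r ^ 6 := by positivity
  have h3 : (b ^ 2) ^ 3 ≤ (r ^ 2 / 16) ^ 3 := pow_le_pow_left₀ hb0 hb 3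
  have h4 : 0 ≤ 15 * r ^ 2 * b ^ 4 := by positivity
  have h5 : 15 * r ^ 4 * b ^ 2 ≤ 15 * r ^ 4 * (r ^ 2 / 16) :=
    mul_le_mul_of_nonneg_left hb (by positivity)
  have hP : 255 / 4096 * r ^ 6 ≤ r ^ 6 - 15 * r ^ 4 * b ^ 2 + 15 * r ^ 2 * b ^ 4 - b ^ 6 := by
    nlinarith [h3, h4, h5]
  calc (r ^ 2 + b ^ 2) ^ 6 ≤ (r ^ 2 + r ^ 2 / 16) ^ 6 :=
        pow_le_pow_left₀ (by positivity) (by linarith) 6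
    _ = 24137569 / 16777216 * (r ^ 6 * r ^ 6) := by ring
    _ ≤ 24 * (255 / 4096) * (r ^ 6 * r ^ 6) :=
        mul_le_mul_of_nonneg_right (by norm_num) (by positivity)
    _ = 24 * (255 / 4096 * r ^ 6) * r ^ 6 := by ring
    _ ≤ 24 * (r ^ 6 - 15 * r ^ 4 * b ^ 2 + 15 * r ^ 2 * b ^ 4 - b ^ 6) * r ^ 6 := by gcongr

/-- **Curvature floor of Kerr away from the poles' strong-spin zone (coordinate level).** At every
point of the Kerr–Schild Cartesian chart with `r > 0` and `r ≥ 4|a|` (so `|a cos θ| ≤ |a| ≤ r/4`),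
`|Rm|²_{g_{M,a}}(x) ≥ 2M²/r⁶` — from the closed form `48 M² Re[(r + i a cos θ)⁶]/(r² + a²cos²θ)⁶`
(proved: `Kerr.kretschmannScalar_closedForm_holds`) and `pow_six_le_of_sq_le`. Unconditional.
[cite: arXiv07060622, §3] -/
theorem le_rmNormSqAt_kerrBilin_of_le_radius : ∀ (M a : ℝ) (x : Literature.Geometry.Lorentzian.E4), 0 < Literature.Geometry.Lorentzian.Kerr.radius a x → 4 * |a| ≤ Literature.Geometry.Lorentzian.Kerr.radius a x → 2 * M ^ 2 / Literature.Geometry.Lorentzian.Kerr.radius a x ^ 6 ≤ Literature.Geometry.Lorentzian.MetricCoord.rmNormSqAt (Literature.Geometry.Lorentzian.Kerr.bilin M a) x := by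
  intro M a x hr hxa
  rw [Kerr.kretschmannScalar_closedForm_holds M a x hr, re_add_mul_I_pow_six]
  set r := Kerr.radius a x with hrdef
  set b := a * (x 3 / r) with hbdef
  have hz : x 3 ^ 2 ≤ r ^ 2 := Kerr.sq_apply_three_le_radius_sq a hr
  have hcos : (x 3 / r) ^ 2 ≤ 1 := by
    rw [div_pow, div_le_one (by positivity)]; exact hz
  have ha2 : a ^ 2 ≤ r ^ 2 / 16 := by
    have h := pow_le_pow_left₀ (by positivity) hxa 2
    rw [mul_pow, sq_abs] at h
    linarith
  have hb : b ^ 2 ≤ r ^ 2 / 16 := by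
    rw [hbdef, mul_pow]
    calc a ^ 2 * (x 3 / r) ^ 2 ≤ r ^ 2 / 16 * 1 :=
          mul_le_mul ha2 hcos (sq_nonneg _) (by positivity)
      _ = r ^ 2 / 16 := by ring
  have hden : 0 < (r ^ 2 + b ^ 2) ^ 6 := by positivity
  have hr6 : 0 < r ^ 6 := by positivity
  rw [div_le_div_iff₀ hr6 hden]
  have key := pow_six_le_of_sq_le hb
  calc 2 * M ^ 2 * (r ^ 2 + b ^ 2) ^ 6 = M ^ 2 * (2 * (r ^ 2 + b ^ 2) ^ 6) := by ring
    _ ≤ M ^ 2 * (2 * (24 * (r ^ 6 - 15 * r ^ 4 * b ^ 2 + 15 * r ^ 2 * b ^ 4 - b ^ 6) * r ^ 6)) :=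
        mul_le_mul_of_nonneg_left (by linarith) (sq_nonneg M)
    _ = 48 * M ^ 2 * (r ^ 6 - 15 * r ^ 4 * b ^ 2 + 15 * r ^ 2 * b ^ 4 - b ^ 6) * r ^ 6 := by ring

/-- **Curvature floor of the Kerr spacetime** `Kerr.spacetime M a r₀` at every point of Kerr–Schild
radius `r ≥ 4|a|`: `kretschmannAt ≥ 2M²/r⁶` (the scalar is read in the inclusion chart, where the
components are `g_{M,a}`: `Kerr.kretschmannAt_spacetime`). [cite: arXiv07060622, §3] -/
theorem le_kretschmannAt_kerr_of_le_radius : ∀ [Literature.Geometry.Lorentzian.Kerr.Facts] {M a r₀ : ℝ} (hM : 0 ≤ M) (x : (Literature.Geometry.Lorentzian.Kerr.spacetime M a r₀ hM).carrier), 4 * |a| ≤ Literature.Geometry.Lorentzian.Kerr.radius a x.1 → 2 * M ^ 2 / Literature.Geometry.Lorentzian.Kerr.radius a x.1 ^ 6 ≤ (Literature.Geometry.Lorentzian.Kerr.spacetime M a r₀ hM).kretschmannAt x := by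
  intro _ M a r₀ hM x hxa
  have hr : 0 < Kerr.radius a x.1 := Kerr.radius_pos_of_mem_region x.2
  rw [Kerr.kretschmannAt_spacetime Kerr.kretschmannScalar_closedForm_holds M a r₀ hM x,
    ← Kerr.kretschmannScalar_closedForm_holds M a x.1 hr]
  exact le_rmNormSqAt_kerrBilin_of_le_radius M a x.1 hr hxa

/-- **The horizon collar of a slowly rotating hole is a curvature wall.** On `Kerr.spacetime M a r₀`
with `0 < M` and chart floor `r₀ ≥ 4|a|` (e.g. `r₀ = M/2` for `|a| ≤ M/8`, reaching across the event
horizon `r₊ ∈ [M, 2M]`), every point of the collar `{r ≤ 3M}` has Kretschmann scalar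
`≥ 2M²/(3M)⁶ = 2/(729 M⁴)`. [cite: arXiv07060622, §3] -/
theorem le_kretschmannAt_kerr_collar : ∀ [Literature.Geometry.Lorentzian.Kerr.Facts] {M a r₀ : ℝ} (hM : 0 < M), 4 * |a| ≤ r₀ → ∀ x : (Literature.Geometry.Lorentzian.Kerr.spacetime M a r₀ hM.le).carrier, Literature.Geometry.Lorentzian.Kerr.radius a x.1 ≤ 3 * M → 2 / (729 * M ^ 4) ≤ (Literature.Geometry.Lorentzian.Kerr.spacetime M a r₀ hM.le).kretschmannAt x := by
  intro _ M a r₀ hM hr₀ x hx3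
  have hx : max r₀ 0 < Kerr.radius a x.1 := Kerr.mem_region.1 x.2
  have hr : 0 < Kerr.radius a x.1 := lt_of_le_of_lt (le_max_right _ _) hx
  have hxa : 4 * |a| ≤ Kerr.radius a x.1 := (hr₀.trans (le_max_left _ _)).trans hx.le
  refine le_trans ?_ (le_kretschmannAt_kerr_of_le_radius hM.le x hxa)
  have h6 : Kerr.radius a x.1 ^ 6 ≤ (3 * M) ^ 6 := pow_le_pow_left₀ hr.le hx3 6
  calc 2 / (729 * M ^ 4) = 2 * M ^ 2 / (3 * M) ^ 6 := by
        field_simp; ring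
    _ ≤ 2 * M ^ 2 / Kerr.radius a x.1 ^ 6 :=
        div_le_div_of_nonneg_left (by positivity) (by positivity) h6

end Summit.FinalStateConjecture.FinalStateConjecture.Theorems.LaminatedThreshold.HorizonShadowedBag

end
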